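import Mathlib
import Literature.Probability.LatticeModels.SharpnessProofs
import HarnessLib

/-!
# Stub `stub_shellSummation` of the line `sup-axis-reflection-transfer` (crux `stmt-QuantumFields-9442`)

Route `FradkinShenkerFlow` of `YangMills`, crux item `stmt-QuantumFields-9442`
(`Summit.QuantumFields.YangMills.Theses.FradkinShenkerFlow.FiniteSusceptibilityWeakCoupling`),
line `sup-axis-reflection-transfer`, stub `stub_shellSummation` (STUB 3 of the lead's skeleton).

What is proved: the **shell summation in `d = 4`**. Let `f : ℤ⁴ → ℝ` be bounded by `K` on the box
`Λ_S = box 4 S`, let `g : ℕ → ℝ` be non-negative with cubic moment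
`∑_{j ≤ S} (j+1)³ g j ≤ M`, and suppose that outside the first `n₀` shells `f` is dominated by
`c ≥ 0` times the lag window of half-width `w` of `g` around `‖x‖_∞`:
`|f x| ≤ c ∑_{j ≤ S, |j - ‖x‖_∞| ≤ w} g j`. Then `∑_{x ∈ Λ_S} |f x| ≤ C` with a constant
`C = (2n₀+1)⁴ |K| + c · 8(2w+1)(2w+2)³ · |M|` that does not depend on `S`.

This is where the dimension `d = 4` enters the line: the shell `∂Λ_n = {‖x‖_∞ = n}` has at most
`8 (2n+1)³` sites (tree `card_sphere_succ_le`), so the lag window of `j` meets at most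
`(2w+1) · 8 (2(j+w)+1)³ ≤ 8(2w+1)(2w+2)³ (j+1)³` sites of the box, which is matched by the cubic
weight of the moment hypothesis after exchanging the two sums.

Only tree facts about `box`, `sphere`, `Site.supNorm` (all proved, `ThermodynamicLimit.lean`,
`SharpnessProofs.lean`) and Mathlib `Finset` algebra are used; no named facts.
-/

noncomputable section

open Finset
open scoped BigOperators
open Literature.Probability.LatticeModels

namespace Summit.QuantumFields.YangMills.Theorems.FiniteSusceptibilityWeakCoupling

namespace ShellSummation

/-- In `d = 4` every shell `∂Λ_n = {x ∈ ℤ⁴ : ‖x‖_∞ = n}` has at most `8 (2n+1)³` sites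
(for `n ≥ 1` this is the tree's `card_sphere_succ_le`; `∂Λ_0 = {0}`). [folklore] -/
theorem card_sphere_four_le (n : ℕ) : (#(sphere 4 n) : ℝ) ≤ 8 * (2 * (n : ℝ) + 1) ^ 3 := by
  cases n with
  | zero =>
    have h : sphere 4 0 ⊆ {0} := by
      intro y hy
      rw [mem_sphere, Site.supNorm_eq_zero_iff] at hy
      rw [hy, mem_singleton]
    have h1 : (#(sphere 4 0) : ℝ) ≤ 1 := by
      exact_mod_cast (card_le_card h).trans (card_singleton (0 : Site 4)).le
    calc (#(sphere 4 0) : ℝ) ≤ 1 := h1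
      _ ≤ 8 * (2 * ((0 : ℕ) : ℝ) + 1) ^ 3 := by norm_num
  | succ k =>
    calc (#(sphere 4 (k + 1)) : ℝ) ≤ 2 * (4 : ℕ) * (2 * k + 3 : ℝ) ^ (4 - 1) :=
          card_sphere_succ_le (d := 4) k
      _ = 8 * (2 * ((k + 1 : ℕ) : ℝ) + 1) ^ 3 := by push_cast; ring

/-- The lag-window count in `d = 4`: the sites of `Λ_S` whose sup norm is within `w` of `j`
number at most `8 (2w+1) (2w+2)³ (j+1)³`, uniformly in `S`. [folklore] -/
theorem card_window_le (S j w : ℕ) :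
    (#((box 4 S).filter fun x => Site.supNorm x ≤ j + w ∧ j ≤ Site.supNorm x + w) : ℝ) ≤
      8 * (2 * (w : ℝ) + 1) * (2 * (w : ℝ) + 2) ^ 3 * ((j : ℝ) + 1) ^ 3 := by
  have hsub : ((box 4 S).filter fun x => Site.supNorm x ≤ j + w ∧ j ≤ Site.supNorm x + w) ⊆
      (Icc (j - w) (j + w)).biUnion fun n => sphere 4 n := by
    intro x hx
    rw [mem_filter] at hx
    rw [mem_biUnion]
    refine ⟨Site.supNorm x, ?_, self_mem_sphere x⟩
    rw [mem_Icc]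
    omega
  have hw : (0 : ℝ) ≤ w := Nat.cast_nonneg w
  have hj : (0 : ℝ) ≤ j := Nat.cast_nonneg j
  have hA : 2 * ((j : ℝ) + w) + 1 ≤ (2 * (w : ℝ) + 2) * ((j : ℝ) + 1) := by
    nlinarith [mul_nonneg hw hj]
  calc (#((box 4 S).filter fun x => Site.supNorm x ≤ j + w ∧ j ≤ Site.supNorm x + w) : ℝ)
      ≤ #((Icc (j - w) (j + w)).biUnion fun n => sphere 4 n) := by
        exact_mod_cast card_le_card hsub
    _ ≤ ∑ n ∈ Icc (j - w) (j + w), (#(sphere 4 n) : ℝ) := by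
        exact_mod_cast card_biUnion_le
    _ ≤ ∑ _n ∈ Icc (j - w) (j + w), 8 * (2 * ((j : ℝ) + w) + 1) ^ 3 := by
        refine sum_le_sum fun n hn => ?_
        rw [mem_Icc] at hn
        have hn' : (n : ℝ) ≤ j + w := by exact_mod_cast hn.2
        calc (#(sphere 4 n) : ℝ) ≤ 8 * (2 * (n : ℝ) + 1) ^ 3 := card_sphere_four_le n
          _ ≤ 8 * (2 * ((j : ℝ) + w) + 1) ^ 3 := by gcongr
    _ = (#(Icc (j - w) (j + w)) : ℝ) * (8 * (2 * ((j : ℝ) + w) + 1) ^ 3) := by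
        rw [sum_const, nsmul_eq_mul]
    _ ≤ (2 * (w : ℝ) + 1) * (8 * (2 * ((j : ℝ) + w) + 1) ^ 3) := by
        gcongr
        have h : #(Icc (j - w) (j + w)) ≤ 2 * w + 1 := by
          rw [Nat.card_Icc]
          omega
        exact_mod_cast h
    _ ≤ (2 * (w : ℝ) + 1) * (8 * ((2 * (w : ℝ) + 2) * ((j : ℝ) + 1)) ^ 3) := by
        gcongr
    _ = 8 * (2 * (w : ℝ) + 1) * (2 * (w : ℝ) + 2) ^ 3 * ((j : ℝ) + 1) ^ 3 := by ring

/-- Exchange of summation: summing the lag window of a sequence `g` over the sites of `Λ_S`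
gives `∑_j g j · #{x ∈ Λ_S : |‖x‖_∞ - j| ≤ w}`. [folklore] -/
theorem sum_window_eq (S w : ℕ) (g : ℕ → ℝ) :
    ∑ x ∈ box 4 S, ∑ j ∈ (range (S + 1)).filter
        (fun j => Site.supNorm x ≤ j + w ∧ j ≤ Site.supNorm x + w), g j =
      ∑ j ∈ range (S + 1), g j *
        #((box 4 S).filter fun x => Site.supNorm x ≤ j + w ∧ j ≤ Site.supNorm x + w) := by
  simp_rw [sum_filter]
  rw [sum_comm]
  refine sum_congr rfl fun j _ => ?_
  rw [← sum_filter, sum_const, nsmul_eq_mul, mul_comm]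

end ShellSummation

open ShellSummation in
/-- **Shell summation in `d = 4`** (STUB 3 of the line `sup-axis-reflection-transfer` of crux
`stmt-QuantumFields-9442`). If `|f| ≤ K` on `Λ_S`, `g ≥ 0` has cubic moment `∑_{j ≤ S} (j+1)³ g j ≤ M`,
and `|f x| ≤ c ∑_{j ≤ S, |j - ‖x‖_∞| ≤ w} g j` for `‖x‖_∞ ≥ n₀`, then
`∑_{x ∈ Λ_S} |f x| ≤ (2n₀+1)⁴ |K| + c · 8(2w+1)(2w+2)³ · |M|`, a bound uniform in `S`.
The first `n₀` shells lie in `Λ_{n₀}` (`card_box`); on the others the sums are exchanged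
(`ShellSummation.sum_window_eq`) and the lag window is counted by
`ShellSummation.card_window_le`. [folklore] -/
theorem stub_shellSummation : ∀ (n₀ w : ℕ) (K c M : ℝ), ∃ C : ℝ, ∀ (S : ℕ) (f : Literature.Probability.LatticeModels.Site 4 → ℝ) (g : ℕ → ℝ), 0 ≤ c → (∀ x ∈ Literature.Probability.LatticeModels.box 4 S, |f x| ≤ K) → (∀ j, 0 ≤ g j) → ∑ j ∈ Finset.range (S + 1), ((j : ℝ) + 1) ^ 3 * g j ≤ M → (∀ x ∈ Literature.Probability.LatticeModels.box 4 S, n₀ ≤ Literature.Probability.LatticeModels.Site.supNorm x → |f x| ≤ c * ∑ j ∈ (Finset.range (S + 1)).filter (fun j => Literature.Probability.LatticeModels.Site.supNorm x ≤ j + w ∧ j ≤ Literature.Probability.LatticeModels.Site.supNorm x + w), g j) → ∑ x ∈ Literature.Probability.LatticeModels.box 4 S, |f x| ≤ C := by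
  intro n₀ w K c M
  refine ⟨(2 * (n₀ : ℝ) + 1) ^ 4 * |K| +
    c * (8 * (2 * (w : ℝ) + 1) * (2 * (w : ℝ) + 2) ^ 3) * |M|, ?_⟩
  intro S f g hc hK hg hM hdom
  have hK0 : 0 ≤ K := (abs_nonneg (f 0)).trans (hK 0 (zero_mem_box 4 S))
  rw [← sum_filter_add_sum_filter_not (box 4 S) (fun x => Site.supNorm x < n₀)]
  refine add_le_add ?_ ?_
  · -- the first `n₀` shells
    have hsub : ((box 4 S).filter fun x => Site.supNorm x < n₀) ⊆ box 4 n₀ := by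
      intro x hx
      rw [mem_filter] at hx
      rw [mem_box_iff_supNorm_le]
      omega
    calc ∑ x ∈ (box 4 S).filter (fun x => Site.supNorm x < n₀), |f x|
        ≤ ∑ _x ∈ (box 4 S).filter (fun x => Site.supNorm x < n₀), K :=
          sum_le_sum fun x hx => hK x (mem_filter.1 hx).1
      _ = (#((box 4 S).filter fun x => Site.supNorm x < n₀) : ℝ) * K := by
          rw [sum_const, nsmul_eq_mul]
      _ ≤ (#(box 4 n₀) : ℝ) * K :=
          mul_le_mul_of_nonneg_right (by exact_mod_cast card_le_card hsub) hK0
      _ = (2 * (n₀ : ℝ) + 1) ^ 4 * K := by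
          rw [card_box]
          push_cast
          ring
      _ ≤ (2 * (n₀ : ℝ) + 1) ^ 4 * |K| := by
          gcongr
          exact le_abs_self K
  · -- the outer shells: domination, exchange of sums, window count
    have hC₁ : (0 : ℝ) ≤ 8 * (2 * (w : ℝ) + 1) * (2 * (w : ℝ) + 2) ^ 3 := by positivity
    calc ∑ x ∈ (box 4 S).filter (fun x => ¬Site.supNorm x < n₀), |f x|
        ≤ ∑ x ∈ (box 4 S).filter (fun x => ¬Site.supNorm x < n₀),
            c * ∑ j ∈ (range (S + 1)).filter
              (fun j => Site.supNorm x ≤ j + w ∧ j ≤ Site.supNorm x + w), g j := by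
          refine sum_le_sum fun x hx => ?_
          rw [mem_filter] at hx
          exact hdom x hx.1 (not_lt.1 hx.2)
      _ ≤ ∑ x ∈ box 4 S, c * ∑ j ∈ (range (S + 1)).filter
              (fun j => Site.supNorm x ≤ j + w ∧ j ≤ Site.supNorm x + w), g j :=
          sum_le_sum_of_subset_of_nonneg (filter_subset _ _)
            fun x _ _ => mul_nonneg hc (sum_nonneg fun j _ => hg j)
      _ = c * ∑ j ∈ range (S + 1), g j *
            #((box 4 S).filter fun x => Site.supNorm x ≤ j + w ∧ j ≤ Site.supNorm x + w) := by
          rw [← mul_sum, sum_window_eq]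
      _ ≤ c * ∑ j ∈ range (S + 1), g j *
            (8 * (2 * (w : ℝ) + 1) * (2 * (w : ℝ) + 2) ^ 3 * ((j : ℝ) + 1) ^ 3) := by
          gcongr with j hj
          · exact hg j
          · exact card_window_le S j w
      _ = c * (8 * (2 * (w : ℝ) + 1) * (2 * (w : ℝ) + 2) ^ 3) *
            ∑ j ∈ range (S + 1), ((j : ℝ) + 1) ^ 3 * g j := by
          rw [mul_sum, mul_sum]
          refine sum_congr rfl fun j _ => ?_
          ring
      _ ≤ c * (8 * (2 * (w : ℝ) + 1) * (2 * (w : ℝ) + 2) ^ 3) * M := by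
          gcongr
      _ ≤ c * (8 * (2 * (w : ℝ) + 1) * (2 * (w : ℝ) + 2) ^ 3) * |M| := by
          gcongr
          exact le_abs_self M

end Summit.QuantumFields.YangMills.Theorems.FiniteSusceptibilityWeakCoupling

end
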